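import Summits.Ventures.PercRepro.Night2FourFatCount
import Summits.Ventures.PercRepro.Night2ThreeFatCellsB

/-!
# PercRepro — the `(7, 5)` cell `(3, 0)` at `|G| = 11` through FOUR disjoint fat hyperplanes, and the residues J
(night-2, gen 23)

The four-disjoint-hyperplane count of `Night2FourFatCount` with the chord excess of gen 20 gives the count sum
`3027/2912 = 1.039 ≥ 1` at `(3, 0)`, `n = 11` (three disjoint hyperplanes: `0.932`): the cell `(3, 0)` at `|G| = 11`
closes whenever four thin members missing `≤ 2` points each miss pairwise disjoint sets
(`localShadowHall_three_zero_six_eleven_of_fourDisjoint`).  **`shadowHall_seven_five_of_residuesJ`** — the `(7, 5)`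
shadow row for every finite matroid modulo the residues I with the extra clause `NoFourDisjointFat N G 2` (every four
thin members missing `≤ 2` points have two with MEETING missed sets) at `(3, 0)`, `|G| = 11`: with it every `(3, 0)`
cell `10 ≤ |G| ≤ 13` carries a «few disjoint fat series pairs» clause.
-/

namespace PercRepro.Shadow

open Finset PerFlat ThmH

/-- The count sum of the cell `(3, 0)` at `n = 11` with the four-disjoint-hyperplane count and `E = 8/27`:
`3027/2912 = 1.039… ≥ 1`. -/
theorem countSum_three_zero_eleven_d4 :
    1 ≤ countSum 11 6 3 (cPrimeDGP 5 3 6 0 2) (8 / 27 : ℚ) (cntDisjFour 6) := by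
  rw [cPrimeDGP_three_zero_two]
  unfold countSum DGenP.cjG cntDisjFour
  rw [show Finset.Icc 1 (11 - 6) = {1, 2, 3, 4, 5} by decide]
  repeat rw [Finset.sum_insert (by decide)]
  rw [Finset.sum_singleton]
  norm_num [Nat.choose_eq_descFactorial_div_factorial, Nat.descFactorial, Nat.factorial]

variable {α : Type*} [DecidableEq α] {M : Matroid α} [M.Finite]

open scoped Classical in
/-- **The cell `(3, 0)` at `|G| = 11` with four fat thin members missing pairwise DISJOINT sets** (`≤ 2` points each):
(LI_G) through the four-disjoint-hyperplane count of the covering bases. -/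
theorem localShadowHall_three_zero_six_eleven_of_fourDisjoint {G : Finset α} (hG : G ∈ flatsQ M (5 + 1))
    (hd : (gr M \ G).card = 3) (hk : kColoops M G = 0)
    (hs : ∀ e ∈ gr M, ∀ f ∈ gr M, e ≠ f → rkN M {e, f} = 2) (hl : ∀ e ∈ gr M, M.Indep {e})
    (hn : G.card = 11) {B₀ B₁ B₂ B₃ : Finset α} (hB₀ : B₀ ∈ thinMembers M 5 G) (hB₁ : B₁ ∈ thinMembers M 5 G)
    (hB₂ : B₂ ∈ thinMembers M 5 G) (hB₃ : B₃ ∈ thinMembers M 5 G)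
    (hfat₀ : (G \ clF M B₀).card ≤ 2) (hfat₁ : (G \ clF M B₁).card ≤ 2) (hfat₂ : (G \ clF M B₂).card ≤ 2)
    (hfat₃ : (G \ clF M B₃).card ≤ 2)
    (hd₀₁ : (G \ clF M B₀) ∩ (G \ clF M B₁) = ∅) (hd₀₂ : (G \ clF M B₀) ∩ (G \ clF M B₂) = ∅)
    (hd₀₃ : (G \ clF M B₀) ∩ (G \ clF M B₃) = ∅) (hd₁₂ : (G \ clF M B₁) ∩ (G \ clF M B₂) = ∅)
    (hd₁₃ : (G \ clF M B₁) ∩ (G \ clF M B₃) = ∅) (hd₂₃ : (G \ clF M B₂) ∩ (G \ clF M B₃) = ∅) :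
    LocalShadowHall M 5 G := by
  have hk' : kColoops M G + 6 = 5 + 1 := by omega
  have hd' : (gr M \ G).card ≤ 5 := by omega
  have hm2 : ∀ B ∈ thinMembers M 5 G, 6 ≤ (B \ coloops M G).card → 2 ≤ (G \ clF M B).card :=
    fun B hB _ => two_le_card_sdiff_of_not_lay0 hG hd' (mem_thinMembers.1 hB).1 (mem_thinMembers.1 hB).2
  have hc2 : 0 ≤ cPrimeDGP 5 3 6 (kColoops M G) 2 := by
    rw [hk]; unfold cPrimeDGP capDG reqDGP phiQ; norm_num
  have hn' : G.card - kColoops M G = 11 := by omega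
  have hKG : coloops M G ⊆ G := fun y hy => (mem_coloops.1 hy).1
  have hnK : (G \ coloops M G).card = 11 := by
    rw [Finset.card_sdiff_of_subset hKG, ← kColoops_eq_card_coloops]; omega
  refine localShadowHall_excess_of_count (d := 3) (ρ := 6) (m₁ := 2) hG hd (by norm_num) hk' (by norm_num)
    hs hl hc2 hm2 (E := (8 / 27 : ℚ)) (by norm_num) ?_ (cnt := cntDisjFour 6) ?_ ?_ ?_
  · intro S _ T hT
    have hT' : T ∈ (S \ coloops M G).powersetCard 6 := by
      unfold coverBases at hT
      exact (Finset.mem_filter.1 hT).1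
    have h := sum_faceLoss_union_le (a := (11 / 45 : ℚ)) (b := (1 / 45 : ℚ)) hG hd (by norm_num) hk' (by omega)
      hs hl (by norm_num) (by rw [hnK]; intro m h1 h2; exact DGenP.chord_three_zero_11 m h1 (by omega))
      (by rw [hnK, hk, DGenP.excessBound_three_zero_11]; norm_num) hT'
    rw [hnK, hk, DGenP.excessBound_three_zero_11] at h
    exact h
  · intro s h1 h2
    rw [hn'] at h2
    exact cntDisjFour_six_pos s h1 (by omega)
  · intro S hSG
    exact card_coverBases_le_cntDisjFour hk' (by norm_num) (coloops_subset_clF_of_mem_thinMembers hG hd' hB₀)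
      (eRk_clF_le_of_mem_thinMembers hB₀) (coloops_subset_clF_of_mem_thinMembers hG hd' hB₁)
      (eRk_clF_le_of_mem_thinMembers hB₁) (coloops_subset_clF_of_mem_thinMembers hG hd' hB₂)
      (eRk_clF_le_of_mem_thinMembers hB₂) (coloops_subset_clF_of_mem_thinMembers hG hd' hB₃)
      (eRk_clF_le_of_mem_thinMembers hB₃) hfat₀ hfat₁ hfat₂ hfat₃ hd₀₁ hd₀₂ hd₀₃ hd₁₂ hd₁₃ hd₂₃ hSG
  · rw [hn', hk]
    exact countSum_three_zero_eleven_d4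

section SevenFiveJ

variable {α' : Type} [DecidableEq α']

/-- «every four thin members missing `≤ m` points have two with MEETING missed sets» — the fat missed sets contain no
four pairwise disjoint members. -/
abbrev NoFourDisjointFat (N : Matroid α') [N.Finite] (G : Finset α') (m : ℕ) : Prop :=
  ∀ B₀ ∈ thinMembers N 5 G, ∀ B₁ ∈ thinMembers N 5 G, ∀ B₂ ∈ thinMembers N 5 G, ∀ B₃ ∈ thinMembers N 5 G,
    (G \ clF N B₀).card ≤ m → (G \ clF N B₁).card ≤ m → (G \ clF N B₂).card ≤ m → (G \ clF N B₃).card ≤ m →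
      (G \ clF N B₀) ∩ (G \ clF N B₁) ≠ ∅ ∨ (G \ clF N B₀) ∩ (G \ clF N B₂) ≠ ∅ ∨
        (G \ clF N B₀) ∩ (G \ clF N B₃) ≠ ∅ ∨ (G \ clF N B₁) ∩ (G \ clF N B₂) ≠ ∅ ∨
        (G \ clF N B₁) ∩ (G \ clF N B₃) ≠ ∅ ∨ (G \ clF N B₂) ∩ (G \ clF N B₃) ≠ ∅

/-- **THE `(7, 5)` SHADOW ROW FOR EVERY FINITE MATROID MODULO THE RESIDUES J**: the residues of
`shadowHall_seven_five_of_residuesI` with, at `(3, 0)`, `|G| = 11`, the extra clause `NoFourDisjointFat N G 2`. -/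
theorem shadowHall_seven_five_of_residuesJ
    (h20 : ∀ (N : Matroid α') [N.Finite] (G : Finset α'), CellHyp N G →
      (gr N \ G).card = 2 → kColoops N G = 0 → FatMember N G 6 3 →
      (FatBasis N G 6 2 ∨ FatMember N G 6 2) → LocalShadowHall N 5 G)
    (h21 : ∀ (N : Matroid α') [N.Finite] (G : Finset α'), CellHyp N G →
      (gr N \ G).card = 2 → kColoops N G = 1 → FatMember N G 5 4 →
      (FatBasis N G 5 3 ∨ FatMember N G 5 3) → LocalShadowHall N 5 G)
    (h30 : ∀ (N : Matroid α') [N.Finite] (G : Finset α'), CellHyp N G →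
      (gr N \ G).card = 3 → kColoops N G = 0 → 10 ≤ G.card → G.card ≤ 13 → FatMember N G 6 2 →
      FatBasis N G 6 2 → (G.card = 13 → NestedFat N G 2 3) →
      (G.card = 10 ∨ G.card = 12 → NoThreeDisjointFat N G 2) → (G.card = 11 → NoFourDisjointFat N G 2) →
      LocalShadowHall N 5 G)
    (h31 : ∀ (N : Matroid α') [N.Finite] (G : Finset α'), CellHyp N G →
      (gr N \ G).card = 3 → kColoops N G = 1 → 11 ≤ G.card → G.card ≤ 17 → FatMember N G 5 2 →
      (G.card = 17 → FatBasis N G 5 2) → (G.card = 17 → NestedFat N G 2 3) →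
      (G.card = 16 → MeetingFat N G 2) → (11 ≤ G.card ∧ G.card ≤ 15 → NoThreeDisjointFat N G 2) →
      (G.card = 11 ∨ G.card = 15 ∨ G.card = 16 → FatBasis N G 5 3) →
      (12 ≤ G.card ∧ G.card ≤ 14 → FatBasis N G 5 4) → LocalShadowHall N 5 G)
    (h32 : ∀ (N : Matroid α') [N.Finite] (G : Finset α'), CellHyp N G →
      (gr N \ G).card = 3 → kColoops N G = 2 → FatMember N G 4 2 → LocalShadowHall N 5 G)
    (M : Matroid α') [M.Finite] : ShadowHall M 7 5 (phiK 7 5) := by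
  apply shadowHall_seven_five_of_residuesI h20 h21 _ h31 h32
  intro N _ G hcell hd hk h10 h13 hfm hfb hnest hnd3
  by_cases hnd : NoFourDisjointFat N G 2
  · exact h30 N G hcell hd hk h10 h13 hfm hfb hnest hnd3 (fun _ => hnd)
  · by_cases hG11 : G.card = 11
    · unfold NoFourDisjointFat at hnd
      push Not at hnd
      obtain ⟨B₀, hB₀, B₁, hB₁, B₂, hB₂, B₃, hB₃, hf₀, hf₁, hf₂, hf₃, hd₀₁, hd₀₂, hd₀₃, hd₁₂, hd₁₃, hd₂₃⟩ := hnd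
      exact localShadowHall_three_zero_six_eleven_of_fourDisjoint hcell.2.2.2 hd hk hcell.1 hcell.2.1 hG11
        hB₀ hB₁ hB₂ hB₃ hf₀ hf₁ hf₂ hf₃ hd₀₁ hd₀₂ hd₀₃ hd₁₂ hd₁₃ hd₂₃
    · exact h30 N G hcell hd hk h10 h13 hfm hfb hnest hnd3 (fun h => absurd h hG11)

end SevenFiveJ

end PercRepro.Shadow
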